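import Summits.CriticalPhenomena.CardyFormulaZ2.Theorems.CardySusyWardParafermionFamiliesToSLESixHalfCRVertexRelation

/-!
# The strip anchor (stub S5 of line `strip-anchored-vertex-normalisation`, crux stmt-CriticalPhenomena-10814), II:
# TouchModulus — the exploration touches a free-wall site iff the site is joined to the wired arc

Helper file for `stub_anchoredWallFlux`. For admissible data `E` with hole-free inner faces, configuration
`ω`, completed configuration `β = E.bcBondConfig ω`, start corner `c₀`, exit time `T`, orbit `orb`:
* `reachable_start_of_orbit` (touch ⇒ joined to `A`): every vertex of the orbit of `c₀` is joined to
  `c₀.1 ∈ A` by `β`-open edges;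
* `touch_of_reachable` (joined to `A` ⇒ touched; registered form `stub_anchor_touch`): for a FREE-WALL
  SITE `w` (face `w` inner, face `w + e₀` not inner, `w + e₀ + e₁` on the arc `B` — the picture at every
  site of level `L - 2` under a diagonal free wall `x₀ + x₁ = L`) joined by `β`-open edges to the arc
  `A`, the corner `(w, 0)` is `orb n` for some `n < T`. Proof: otherwise the forward orbit of `(w,0)`
  never leaves the inner faces (`isInnerFace_iterate`: leaving happens across `e_a` or `e_b`, both
  excluded), hence is a cycle; the winding number of its coded closed trail (`MedialTrailUmlaufsatz`,
  `FKLoopWindingCells`) jumps by one from the vertex cell of `w` to the cell of the face `w`, which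
  carries the winding number `0` of the non-inner face `w + e₀` (tube lemma around the `B`-site
  `w + e₀ + e₁`, hole-freeness); but vertex cells have constant winding number along open edges
  (`wnd_vcell_eq_of_mem`) and winding number `0` at boundary sites — contradiction;
* `touch_iff` (both directions).
-/

noncomputable section

namespace Summit.CriticalPhenomena.CardyFormulaZ2.Theorems.ParafermionFamiliesToSLESix.StripAnchored

open Function
open Literature.Probability.Percolation (BondConfig vcell fcell cornerDart cornerDart_eq isDart_cornerDart
  cornerDart_injective lf_cornerDart rf_cornerDart orbitTrail isTrail_orbitTrail mem_cdarts_orbitTrail_iff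
  wnd_vcell_sub_wnd_fcell orbitTrail_eq_cornerOrbit cornerOrbit_ne_of_lt_minimalPeriod)
open Literature.Probability.LatticeModels
open Literature.Probability.LatticeModels.DiscreteDobrushin (startCorner exitTime isStartCorner_startCorner
  isInnerFace_of_lt_exitTime not_isInnerFace_exitTime)
open Literature.Probability.LatticeModels.MedialTrail (wnd lf rf IsDart IsTrail cdarts tube)

namespace S5

variable {E : DiscreteDobrushin} {ω : BondConfig (Site 2)}

/-! ## Touch ⇒ joined to the wired arc -/

/-- **Every vertex of the exploration is joined to the start vertex by open edges** of the completed
configuration (following an open edge moves the vertex along it; crossing a closed edge keeps it).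
[cite: Smirnov2001, §2] -/
theorem reachable_start_of_orbit (c₀ : Site 2 × Fin 4) (n : ℕ) :
    (SimpleGraph.fromEdgeSet (E.bcBondConfig ω)).Reachable (cornerOrbit (E.bcBondConfig ω) c₀ n).1 c₀.1 := by
  induction n with
  | zero => exact SimpleGraph.Reachable.refl _
  | succ n ih =>
    rw [cornerOrbit_succ]
    by_cases h : cTgt (cornerOrbit (E.bcBondConfig ω) c₀ n) ∈ E.bcBondConfig ω
    · rw [nextCorner_of_mem h]
      refine SimpleGraph.Reachable.trans (SimpleGraph.Adj.reachable ?_) ih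
      rw [SimpleGraph.fromEdgeSet_adj]
      refine ⟨by rw [Sym2.eq_swap]; exact h, ?_⟩
      intro heq
      have := cornerUnit_ne_zero ((cornerOrbit (E.bcBondConfig ω) c₀ n).2 + 1)
      exact this (by simpa using heq)
    · rw [nextCorner_of_not_mem h]; exact ih

/-! ## Elementary facts on the turning rule -/

/-- Iterates of the successor map are injective. [folklore] -/
theorem iterate_nextCorner_injective (β : BondConfig (Site 2)) (m : ℕ) : Injective ((nextCorner β)^[m]) :=
  Injective.iterate nextCorner_injective m

/-- **No vertex of a forward orbit lies on the arc `B`** once the first one does not: crossing keeps the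
vertex, following moves it along an open edge of the completed configuration, which avoids `B`.
[cite: Smirnov2001, §2] -/
theorem notB_nextCorner (hE : E.IsZdAdmissible) {q : Site 2 × Fin 4} (h : q.1 ∉ E.zdArcB) :
    (nextCorner (E.bcBondConfig ω) q).1 ∉ E.zdArcB := by
  by_cases he : cTgt q ∈ E.bcBondConfig ω
  · rw [nextCorner_of_mem he]
    exact fun hB => DiscreteDobrushin.not_mem_bcBondConfig_of_mem_zdArcB hE (Sym2.mem_mk_right _ _) hB he
  · rw [nextCorner_of_not_mem he]; exact h

/-- The same along any forward orbit. [cite: Smirnov2001, §2] -/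
theorem notB_iterate (hE : E.IsZdAdmissible) {c : Site 2 × Fin 4} (h : c.1 ∉ E.zdArcB) (m : ℕ) :
    ((nextCorner (E.bcBondConfig ω))^[m] c).1 ∉ E.zdArcB := by
  induction m with
  | zero => exact h
  | succ m ih => rw [iterate_succ_apply']; exact notB_nextCorner hE ih

/-! ## The forward orbit of a corner off the cut orbit stays inside -/

section Inside

variable (hE : E.IsZdAdmissible)

/-- **Leaving the inner faces.** If a corner `q` with inner face and vertex off the arc `B` is followed
by a corner with non-inner face, then `q` is the exit corner `orb (T - 1)` of the cut orbit (the last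
corner with inner face). [cite: Smirnov2001, §2] -/
theorem eq_exit_of_leaving {q : Site 2 × Fin 4} (hq : E.IsInnerFace (cFace q)) (hnB : q.1 ∉ E.zdArcB)
    (hout : ¬ E.IsInnerFace (cFace (nextCorner (E.bcBondConfig ω) q))) :
    q = cornerOrbit (E.bcBondConfig ω) (startCorner hE) (exitTime hE ω - 1) := by
  set β := E.bcBondConfig ω; set c₀ := startCorner hE; set T := exitTime hE ω
  have hc₀ := isStartCorner_startCorner hE
  have hclosed : cTgt q ∉ β := fun h => hout (by rwa [cFace_nextCorner_of_mem h])
  rw [cFace_nextCorner_of_not_mem hclosed] at hout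
  have hIn : E.IsInEdge q.1 (q.2 + 1) := ⟨by rw [fin4_add_one_add_three]; exact hq, hout⟩
  obtain ⟨h1, h2⟩ := hE.arcs_cover_faceBoundary hIn.isFaceBoundaryEdge
  have hA : q.1 ∈ E.zdArcA := h1.resolve_right hnB
  have hB : q.1 + cornerUnit (q.2 + 1) ∈ E.zdArcB := by
    rcases h2 with h2 | h2
    · exact absurd (DiscreteDobrushin.mem_bcBondConfig_of_arcA hIn.isFaceBoundaryEdge.1 (fun x hx => by
        rcases Sym2.mem_iff.1 hx with rfl | rfl; exacts [hA, h2])) hclosed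
    · exact h2
  have hmem : cSrc (q.1, q.2 + 1) ∈ E.zdABEdges := DiscreteDobrushin.cSrc_mem_zdABEdges hA hB (Or.inr hIn)
  -- the two `A`–`B` edges: `e_a = cSrc c₀` and `e_b = cTgt (orb (T - 1))`
  have hT : 0 < T := DiscreteDobrushin.exitTime_pos hE ω
  have hTin : E.IsInnerFace (cFace (cornerOrbit β c₀ (T - 1))) := isInnerFace_of_lt_exitTime hE ω (by omega)
  have hTout : ¬ E.IsInnerFace (cFace (cornerOrbit β c₀ (T - 1 + 1))) := by
    rw [Nat.sub_add_cancel hT]; exact not_isInnerFace_exitTime hE ω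
  have hea : cSrc c₀ ∈ E.zdABEdges :=
    DiscreteDobrushin.cSrc_mem_zdABEdges hc₀.mem_zdArcA hc₀.mem_zdArcB (Or.inl hc₀.isOutEdge)
  have heb : cTgt (cornerOrbit β c₀ (T - 1)) ∈ E.zdABEdges := cTgt_exit_mem_zdABEdges hE hc₀ hTin hTout
  have hne : cSrc c₀ ≠ cTgt (cornerOrbit β c₀ (T - 1)) := (cTgt_exit_ne_cSrc_start hE hc₀ hTin hTout).symm
  -- a two-element set: `hmem` is one of the two distinct members `hea`, `heb` (inlined; the named
  -- form is `…LagHandOff.CrosscutDictionary.eq_or_eq_of_ncard_eq_two`, not imported to keep the cone small)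
  have h2 : ∀ {s : Set (Sym2 (Site 2))}, s.ncard = 2 → ∀ {a b c : Sym2 (Site 2)},
      a ∈ s → b ∈ s → a ≠ b → c ∈ s → c = a ∨ c = b := by
    intro s hs a b c ha hb hab hc
    obtain ⟨x, y, -, rfl⟩ := Set.ncard_eq_two.1 hs
    simp only [Set.mem_insert_iff, Set.mem_singleton_iff] at ha hb hc
    rcases ha with rfl | rfl <;> rcases hb with rfl | rfl <;> rcases hc with rfl | rfl <;> tauto
  rcases h2 hE.ncard_zdABEdges_eq_two hea heb hne hmem with h | h
  · -- across `e_a`: the corner `(q.1, q.2 + 1)` would be the start corner, which is sourced, not targeted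
    obtain ⟨h1', h2'⟩ := Prod.ext_iff.1
      (DiscreteDobrushin.eq_of_cSrc_eq_of_arcs hE (p := (q.1, q.2 + 1)) (q := c₀) hA hc₀.mem_zdArcB h)
    simp only at h1' h2'
    rw [h1', h2'] at hIn
    exact absurd hIn hc₀.isOutEdge.not_isInEdge
  · -- across `e_b`: `q` is the exit corner
    obtain ⟨-, -, hB', -⟩ := cornerOrbit_exit hE hc₀ hTin hTout
    obtain ⟨h1', h2'⟩ := Prod.ext_iff.1 (DiscreteDobrushin.eq_of_cSrc_eq_of_arcs hE (p := (q.1, q.2 + 1))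
      (q := ((cornerOrbit β c₀ (T - 1)).1, (cornerOrbit β c₀ (T - 1)).2 + 1)) hA hB' h)
    simp only at h1' h2'
    exact Prod.ext h1' (add_right_cancel h2')

/-- **The forward orbit of an inner corner off the cut orbit stays inside the inner faces.** For a corner
`c` with inner face and vertex off the arc `B`, which is not one of the corners `orb 0, …, orb (T - 1)` of
the cut orbit, all its iterates under the turning rule have inner faces. [cite: Smirnov2001, §2] -/
theorem isInnerFace_iterate {c : Site 2 × Fin 4} (hc : E.IsInnerFace (cFace c)) (hnB : c.1 ∉ E.zdArcB)
    (hoff : ∀ n < exitTime hE ω, cornerOrbit (E.bcBondConfig ω) (startCorner hE) n ≠ c) (m : ℕ) :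
    E.IsInnerFace (cFace ((nextCorner (E.bcBondConfig ω))^[m] c)) := by
  set β := E.bcBondConfig ω; set c₀ := startCorner hE; set T := exitTime hE ω
  have hc₀ := isStartCorner_startCorner hE
  have hT : 0 < T := DiscreteDobrushin.exitTime_pos hE ω
  induction m using Nat.strong_induction_on with
  | _ m ih =>
    rcases m with _ | m
    · exact hc
    · by_contra hout
      rw [iterate_succ_apply'] at hout
      have heq := eq_exit_of_leaving hE (ih m (Nat.lt_succ_self m)) (notB_iterate hE hnB m) hout
      rw [cornerOrbit_eq_iterate] at heq
      rcases le_or_gt m (T - 1) with hle | hlt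
      · -- then `c = orb (T - 1 - m)`, on the cut orbit
        obtain ⟨d, hd⟩ : ∃ d, T - 1 = m + d := ⟨T - 1 - m, by omega⟩
        rw [hd, iterate_add_apply] at heq
        exact hoff d (by omega) (by rw [cornerOrbit_eq_iterate]; exact (iterate_nextCorner_injective β m heq).symm)
      · -- then `c₀ = next (next^[m - T] c)` with `next^[m - T] c` an inner corner
        obtain ⟨d, hd⟩ : ∃ d, m = (T - 1) + (d + 1) := ⟨m - T, by omega⟩
        have heq' : (nextCorner β)^[T - 1] ((nextCorner β)^[d + 1] c) = (nextCorner β)^[T - 1] c₀ := by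
          rw [← iterate_add_apply, ← hd]; exact heq
        have h0 := iterate_nextCorner_injective β (T - 1) heq'
        rw [iterate_succ_apply'] at h0
        exact nextCorner_ne_start hE hc₀ (ih d (by omega)) h0

/-- Such a corner is a periodic point of the turning rule (its forward orbit lives in the finite set of
corners with inner faces, and the turning rule is injective). [folklore] -/
theorem mem_periodicPts_of_off {c : Site 2 × Fin 4} (hc : E.IsInnerFace (cFace c)) (hnB : c.1 ∉ E.zdArcB)
    (hoff : ∀ n < exitTime hE ω, cornerOrbit (E.bcBondConfig ω) (startCorner hE) n ≠ c) :
    c ∈ periodicPts (nextCorner (E.bcBondConfig ω)) := by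
  set β := E.bcBondConfig ω
  obtain ⟨i, j, hij, h⟩ := (finite_innerCorners hE).exists_lt_map_eq_of_forall_mem
    (f := fun m : ℕ => (nextCorner β)^[m] c) (fun m => isInnerFace_iterate hE hc hnB hoff m)
  obtain ⟨d, hd⟩ : ∃ d, j = d + i := ⟨j - i, by omega⟩
  have h' : (nextCorner β)^[i] ((nextCorner β)^[d] c) = (nextCorner β)^[i] c := by
    rw [← iterate_add_apply, add_comm, ← hd]; exact h.symm
  exact mk_mem_periodicPts (by omega : 0 < d) (iterate_nextCorner_injective β i h')

end Inside

/-! ## Winding numbers of the cycle through a corner off the cut orbit -/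

section Winding

variable {β : BondConfig (Site 2)} {c : Site 2 × Fin 4}

/-- Membership of darts of corners in the cycle is invariant under the successor map. [folklore] -/
theorem mem_cdarts_nextCorner_iff (hp : c ∈ periodicPts (nextCorner β)) (q : Site 2 × Fin 4) :
    cornerDart (nextCorner β q) ∈ cdarts (orbitTrail β c) ↔ cornerDart q ∈ cdarts (orbitTrail β c) := by
  rw [mem_cdarts_orbitTrail_iff hp, mem_cdarts_orbitTrail_iff hp]
  constructor
  · rintro ⟨m, hm⟩
    rcases m with _ | m
    · -- `c = next q`: then `q = next^[Q - 1] c`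
      have hQ := minimalPeriod_pos_of_mem_periodicPts hp
      refine ⟨minimalPeriod (nextCorner β) c - 1, nextCorner_injective (β := β) ?_⟩
      have key : (nextCorner β)^[minimalPeriod (nextCorner β) c - 1 + 1] c = c := by
        rw [Nat.sub_add_cancel hQ, iterate_minimalPeriod]
      rw [iterate_succ_apply'] at key
      rw [key]; simpa using hm
    · refine ⟨m, nextCorner_injective (β := β) ?_⟩
      rw [← iterate_succ_apply' (nextCorner β)]; exact hm
  · rintro ⟨m, hm⟩
    exact ⟨m + 1, by rw [iterate_succ_apply', hm]⟩

/-- **Along an open edge the winding number of the vertex cells does not change.** [folklore] -/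
theorem wnd_vcell_eq_of_mem (hp : c ∈ periodicPts (nextCorner β)) {v : Site 2} {k : Fin 4}
    (he : cSrc (v, k) ∈ β) :
    wnd (orbitTrail β c) (vcell v) = wnd (orbitTrail β c) (vcell (v + cornerUnit k)) := by
  have hT := isTrail_orbitTrail hp
  set d : Site 2 × Fin 4 := (v, k + 3) with hd
  have he' : cTgt d ∈ β := by
    have : cTgt d = cSrc (v, k) := by rw [hd, cTgt, cSrc, fin4_add_three_add_one]
    rw [this]; exact he
  have hnext : nextCorner β d = (v + cornerUnit k, k + 3 + 3) := by
    rw [nextCorner_of_mem he', hd, fin4_add_three_add_one]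
  have hcc' : (cornerDart d).2 = (cornerDart (nextCorner β d)).1 := S2.cornerDart_snd_eq_nextCorner (β := β) d
  have hlf : lf (cornerDart (nextCorner β d)) = vcell (v + cornerUnit k) := by rw [lf_cornerDart, hnext]
  have hrf : rf (cornerDart (nextCorner β d)) = rf (cornerDart d) := by
    rw [rf_cornerDart, rf_cornerDart, cFace_nextCorner_of_mem he']
  by_cases hmem : cornerDart d ∈ cdarts (orbitTrail β c)
  · have h1 := hT.wnd_lf hmem
    have h2 := hT.wnd_lf ((mem_cdarts_nextCorner_iff hp d).2 hmem)
    rw [lf_cornerDart] at h1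
    rw [hlf, hrf] at h2
    rw [h1, h2]
  · obtain ⟨h1, h2, -⟩ := S2.tube_cornerDart hT.2.2 hcc' hmem (fun h => hmem ((mem_cdarts_nextCorner_iff hp d).1 h))
    rw [lf_cornerDart] at h1
    rw [hlf] at h2
    rw [h1, h2]

/-- **Along open paths the winding number of the vertex cells does not change.** [folklore] -/
theorem wnd_vcell_eq_of_reachable (hp : c ∈ periodicPts (nextCorner β)) (hβ : β ⊆ (zdGraph 2).edgeSet)
    {v v' : Site 2} (h : (SimpleGraph.fromEdgeSet β).Reachable v v') :
    wnd (orbitTrail β c) (vcell v) = wnd (orbitTrail β c) (vcell v') := by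
  obtain ⟨p⟩ := h
  induction p with
  | nil => rfl
  | @cons u v _ hadj _ ih =>
    rw [SimpleGraph.fromEdgeSet_adj] at hadj
    obtain ⟨k, rfl⟩ := exists_eq_add_cornerUnit (show (zdGraph 2).Adj u v from hβ hadj.1)
    exact (wnd_vcell_eq_of_mem hp (v := u) (k := k) hadj.1).trans ih

/-- **At a corner of a non-inner face the winding number of the vertex cell vanishes**, for the cycle of a
corner all of whose iterates have inner faces, in hole-free data. [folklore] -/
theorem wnd_vcell_eq_zero_of_isCorner (hH : HoleFree {f : Site 2 | E.IsInnerFace f})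
    (hp : c ∈ periodicPts (nextCorner β)) (hLin : ∀ m, E.IsInnerFace (cFace ((nextCorner β)^[m] c)))
    {a g : Site 2} (hag : IsCorner a g) (hg : ¬ E.IsInnerFace g) : wnd (orbitTrail β c) (vcell a) = 0 := by
  obtain ⟨j, rfl⟩ := exists_faceAt_of_isCorner hag
  -- the corner `(a, j)` and its follow-predecessor `(a + u_j, j + 1)`, both in the non-inner face `faceAt a j`
  set c' : Site 2 × Fin 4 := (a, j) with hc'
  set p₂ : Site 2 × Fin 4 := (a + cornerUnit j, j + 1) with hp₂
  have hface : cFace p₂ = faceAt a j := by rw [hp₂, cFace]; exact faceAt_add_unit_succ a j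
  have htgt : cTgt p₂ = cSrc c' := by
    rw [hp₂, hc', cTgt, cSrc, fin4_add_one_add_one, cornerUnit_add_two, ← sub_eq_add_neg, add_sub_cancel_right,
      Sym2.eq_swap]
  have hnext : nextCorner {cSrc c'} p₂ = c' := by
    rw [nextCorner_of_mem (show cTgt p₂ ∈ ({cSrc c'} : BondConfig (Site 2)) by rw [htgt]; rfl), hp₂, hc']
    simp only
    rw [fin4_add_one_add_one, cornerUnit_add_two, fin4_add_one_add_three]
    ext <;> simp
  have hcc' : (cornerDart p₂).2 = (cornerDart c').1 := by
    rw [S2.cornerDart_snd_eq_nextCorner (β := {cSrc c'}) p₂, hnext]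
  have noff : ∀ q : Site 2 × Fin 4, cFace q = faceAt a j → cornerDart q ∉ cdarts (orbitTrail β c) := by
    intro q hq hmem
    obtain ⟨m, rfl⟩ := (mem_cdarts_orbitTrail_iff hp).1 hmem
    exact hg (hq ▸ hLin m)
  obtain ⟨-, h2, -⟩ := S2.tube_cornerDart (isTrail_orbitTrail hp).2.2 hcc' (noff p₂ hface) (noff c' rfl)
  rw [lf_cornerDart, rf_cornerDart, hface, hc'] at h2
  simp only at h2
  rw [h2, orbitTrail_eq_cornerOrbit]
  exact S2.wnd_fcell_eq_zero_of_not_isInnerFace hH (minimalPeriod_pos_of_mem_periodicPts hp)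
    (by rw [cornerOrbit_eq_iterate]; exact iterate_minimalPeriod) (cornerOrbit_ne_of_lt_minimalPeriod hp)
    (fun m => by rw [cornerOrbit_eq_iterate]; exact hLin m) hg

/-- A site of the discrete boundary is a corner of a non-inner face. [cite: Smirnov2001, §2] -/
theorem exists_not_isInnerFace_of_mem_zdBoundary {a : Site 2} (ha : a ∈ E.zdBoundary) :
    ∃ g, IsCorner a g ∧ ¬ E.IsInnerFace g := by
  rcases ha with ha | ⟨y, -, -, g, hg, hag, -⟩
  · obtain ⟨-, y, hadj, hnot⟩ := (mem_meshBoundary_iff).1 ha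
    obtain ⟨k, rfl⟩ := exists_eq_add_cornerUnit hadj
    exact ⟨faceAt a k, isCorner_faceAt a k, fun hf => hnot (DiscreteDobrushin.adj_of_isInnerFace_faceAt hf (Or.inl rfl))⟩
  · exact ⟨g, hag, hg⟩

end Winding

/-! ## Joined to the wired arc ⇒ touched -/

/-- The faces around the site `w + e₀ + e₁`: face `2` is `w`, face `3` is `w + e₀`. [folklore] -/
theorem cFace_corner_site (w : Site 2) :
    cFace (w + cornerUnit 0 + cornerUnit 1, 2) = w ∧ cFace (w + cornerUnit 0 + cornerUnit 1, 3) = w + cornerUnit 0 ∧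
      cFace (w, 0) = w := by
  refine ⟨?_, ?_, ?_⟩ <;> ext i <;> fin_cases i <;> simp [cFace, faceAt, cornerOff, cornerUnit]

/-- **TouchModulus, planar direction: a free-wall site joined to the wired arc is touched by the
exploration** (face `w` inner, face `w + e₀` not inner, `w + e₀ + e₁` on the arc `B`; `w` joined to a site of
the arc `A` by open edges of the completed configuration ⇒ `(w, 0) = orb n` for some `n < T`).
[cite: DuminilCopin2012Parafermion, Proposition 5] -/
theorem touch_of_reachable (hE : E.IsZdAdmissible) (hH : HoleFree {f : Site 2 | E.IsInnerFace f}) {w a : Site 2}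
    (hw : E.IsInnerFace w) (hw' : ¬ E.IsInnerFace (w + cornerUnit 0))
    (hu : w + cornerUnit 0 + cornerUnit 1 ∈ E.zdArcB) (ha : a ∈ E.zdArcA)
    (hreach : (SimpleGraph.fromEdgeSet (E.bcBondConfig ω)).Reachable w a) :
    ∃ n < exitTime hE ω, cornerOrbit (E.bcBondConfig ω) (startCorner hE) n = (w, 0) := by
  set β := E.bcBondConfig ω
  obtain ⟨e2, e3, e0⟩ := cFace_corner_site w
  by_contra hoff
  push Not at hoff
  have hc : E.IsInnerFace (cFace (w, 0)) := by rw [e0]; exact hw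
  have hnB : (w, (0 : Fin 4)).1 ∉ E.zdArcB := by
    obtain ⟨p⟩ := hreach
    cases p with
    | nil => exact fun hB => Set.disjoint_left.1 hE.disjoint ha hB
    | cons hadj _ =>
      rw [SimpleGraph.fromEdgeSet_adj] at hadj
      exact fun hB => DiscreteDobrushin.not_mem_bcBondConfig_of_mem_zdArcB hE (Sym2.mem_mk_left _ _) hB hadj.1
  have hp := mem_periodicPts_of_off hE hc hnB hoff
  have hLin := isInnerFace_iterate hE hc hnB hoff
  have hT := isTrail_orbitTrail hp
  set l := orbitTrail β (w, 0)
  -- jump across the dart of `(w, 0)`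
  have h1 : wnd l (vcell w) - wnd l (fcell w) = 1 := by
    have := wnd_vcell_sub_wnd_fcell hp (w, 0)
    rwa [e0, if_pos ⟨0, rfl⟩] at this
  -- no corner of the cycle has the `B`-site `u = w + e₀ + e₁` as its vertex
  set u := w + cornerUnit 0 + cornerUnit 1
  have hnotu : ∀ k : Fin 4, cornerDart (u, k) ∉ cdarts l := by
    intro k hmem
    obtain ⟨m, hm⟩ := (mem_cdarts_orbitTrail_iff hp).1 hmem
    have := notB_iterate (ω := ω) hE hnB m
    rw [hm] at this
    exact this hu
  -- tube around `u`: the cells of the faces `w` and `w + e₀` carry the same winding number, zero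
  have h2 : wnd l (fcell w) = wnd l (fcell (w + cornerUnit 0)) := by
    obtain ⟨-, -, h3⟩ := S2.tube_cornerDart hT.2.2 (S2.cornerDart_snd_eq (u, 2)) (hnotu 2) (hnotu 3)
    rw [rf_cornerDart, rf_cornerDart] at h3
    simp only at h3
    rw [show (2 : Fin 4) + 1 = 3 from rfl, e2, e3] at h3
    exact h3.symm
  have h3 : wnd l (fcell (w + cornerUnit 0)) = 0 := by
    rw [show l = orbitTrail β (w, 0) from rfl, orbitTrail_eq_cornerOrbit]
    exact S2.wnd_fcell_eq_zero_of_not_isInnerFace hH (minimalPeriod_pos_of_mem_periodicPts hp)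
      (by rw [cornerOrbit_eq_iterate]; exact iterate_minimalPeriod) (cornerOrbit_ne_of_lt_minimalPeriod hp)
      (fun m => by rw [cornerOrbit_eq_iterate]; exact hLin m) hw'
  -- along the open path to `a ∈ A ⊆ zdBoundary`, the vertex cells carry winding number zero
  obtain ⟨g, hag, hg⟩ := exists_not_isInnerFace_of_mem_zdBoundary (E.zdArcA_subset_zdBoundary ha)
  have hβ : β ⊆ (zdGraph 2).edgeSet := fun e he =>
    SimpleGraph.edgeSet_subset_edgeSet.2 (meshGraph_le_zdGraph _ _)
      (SimpleGraph.edgeSet_subset_edgeSet.2 (discreteDomainGraph_le_meshGraph _ _) (E.bcBondConfig_subset ω he))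
  have h4 : wnd l (vcell w) = 0 := by
    rw [wnd_vcell_eq_of_reachable hp hβ hreach]
    exact wnd_vcell_eq_zero_of_isCorner hH hp hLin hag hg
  rw [h2, h3, h4] at h1
  norm_num at h1

/-- **TouchModulus** (both directions): under the free-wall hypotheses at `w`, the corner `(w, 0)` is on
the cut orbit iff `w` is joined to the wired arc by open edges of the completed configuration.
[cite: DuminilCopin2012Parafermion, Proposition 5] -/
theorem touch_iff (hE : E.IsZdAdmissible) (hH : HoleFree {f : Site 2 | E.IsInnerFace f}) {w : Site 2}
    (hw : E.IsInnerFace w) (hw' : ¬ E.IsInnerFace (w + cornerUnit 0)) (hu : w + cornerUnit 0 + cornerUnit 1 ∈ E.zdArcB) :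
    (∃ n < exitTime hE ω, cornerOrbit (E.bcBondConfig ω) (startCorner hE) n = (w, 0)) ↔
      ∃ a ∈ E.zdArcA, (SimpleGraph.fromEdgeSet (E.bcBondConfig ω)).Reachable w a := by
  constructor
  · rintro ⟨n, -, hn⟩
    refine ⟨(startCorner hE).1, (isStartCorner_startCorner hE).mem_zdArcA, ?_⟩
    have := reachable_start_of_orbit (E := E) (ω := ω) (startCorner hE) n
    rwa [hn] at this
  · rintro ⟨a, ha, hreach⟩
    exact touch_of_reachable hE hH hw hw' hu ha hreach

end S5

/-- **Registered one-line form `stub_anchor_touch`** of `S5.touch_of_reachable` (helper of stub S5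
`stub_anchoredWallFlux`): a free-wall site joined to the wired arc is touched by the exploration.
[cite: DuminilCopin2012Parafermion, Proposition 5] -/
theorem stub_anchor_touch : ∀ (E : DiscreteDobrushin) (hE : E.IsZdAdmissible) (ω : BondConfig (Site 2)) (w a : Site 2), HoleFree {f : Site 2 | E.IsInnerFace f} → E.IsInnerFace w → ¬ E.IsInnerFace (w + cornerUnit 0) → w + cornerUnit 0 + cornerUnit 1 ∈ E.zdArcB → a ∈ E.zdArcA → (SimpleGraph.fromEdgeSet (E.bcBondConfig ω)).Reachable w a → ∃ n < exitTime hE ω, cornerOrbit (E.bcBondConfig ω) (startCorner hE) n = (w, 0) :=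
  fun _ hE _ _ _ hH hw hw' hu ha hreach => S5.touch_of_reachable hE hH hw hw' hu ha hreach



end Summit.CriticalPhenomena.CardyFormulaZ2.Theorems.ParafermionFamiliesToSLESix.StripAnchored

end
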